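import Summits.CriticalPhenomena.PercolationContinuityZ3.Theorems.PercNearOneGluingNoHeavyLowerTailPortSelection
import HarnessLib

/-!
# `NoHeavyLowerTail` (stmt-CriticalPhenomena-4575) — the champion comparison for observers of ARBITRARY DEPTH that are
# uniformly port-dominated (depth-free class theorem, all `|A|`, all `j`)

Lemma factory #6 (`prim-lf-6`, gen 4), 2026-08-19; corollary of the Steiner-blob decomposition (`…SteinerBlobContraction`,
`…SteinerBlobMeasure`, `…PortSelection`).  If a relay `c` is, for every blob `V₀ ∋ o` disjoint from `A`, at least as fragile
AVOIDING `V₀` as every relay adjacent to `V₀`, then the T-form `μ{1 ≤ N_o ≤ j} ≤ μ(N_o ≥ 1, |π(c)| ≤ j)` (⟺ TCS(G,o,c)) and the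
cumulative isolation inequality `μ{1 ≤ N_o ≤ j} ≤ μ{|π(c)| ≤ j}` hold — Kozma–Nitzan's Theorem 8 (the case `V₀ = {o}`, one-layer
observers) extended to every depth by conditioning on the observer's relay-free cluster.  Scope (seat census, memo CANDIDATES.md §B4.2):
the champion of `G` satisfies the hypothesis in ≈ 80 % of random instances with Steiner vertices (`n ≤ 8`, `k ≤ 5`).
No definitions, no sorries.
-/

namespace Summit.CriticalPhenomena.PercolationContinuityZ3.Theorems

open MeasureTheory Set Literature.Probability.LatticeModels Literature.Probability.Percolation
open scoped Classical BigOperators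

variable {n : ℕ}

open SteinerBlob in
/-- **T-form (TCS) at a uniformly port-dominating designee.**  If the relay `c` is, for EVERY blob `V₀ ∋ o` disjoint from `A`,
at least as fragile AVOIDING `V₀` as every relay adjacent to `V₀` (in particular for every realizable relay-free cluster of `o`),
then `μ{1 ≤ N_o ≤ j} ≤ μ({N_o ≥ 1} ∩ {|π(c)| ≤ j})` — the T-form of the champion comparison (⟺ TCS(G,o,c)), for observers of
ARBITRARY depth, all `|A|`, all `j`.  (Constant selection in `SteinerBlob.lowerTail_le_sum_selection` + the blob partition.)
The one-layer case (`V₀ = {o}` only) is Kozma–Nitzan's Theorem 8. [this work] -/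
theorem tform_of_portDominated (w : Sym2 (Fin n) → unitInterval) (A : Finset (Fin n)) (o c : Fin n) (j : ℕ)
    (hoA : o ∉ A) (hc : c ∈ A)
    (hdom : ∀ V₀ : Finset (Fin n), o ∈ V₀ → Disjoint V₀ A →
      ∀ v ∈ A, (∃ u ∈ V₀, w s(u, v) ≠ 0) →
        (prodBernoulli w).real {ω : BondConfig (Fin n) |
            (A.filter fun z => ω ∈ openConnIn ((↑V₀ : Set (Fin n))ᶜ) v z).card ≤ j} ≤
          (prodBernoulli w).real {ω : BondConfig (Fin n) |
            (A.filter fun z => ω ∈ openConnIn ((↑V₀ : Set (Fin n))ᶜ) c z).card ≤ j}) :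
    (prodBernoulli w).real {ω : BondConfig (Fin n) |
        1 ≤ (A.filter fun x => ω ∈ openConn o x).card ∧ (A.filter fun x => ω ∈ openConn o x).card ≤ j} ≤
      (prodBernoulli w).real ({ω : BondConfig (Fin n) | 1 ≤ (A.filter fun x => ω ∈ openConn o x).card} ∩
        {ω : BondConfig (Fin n) | (A.filter fun x => ω ∈ openConn c x).card ≤ j}) := by
  have h := lowerTail_le_sum_selection w A o j hoA (fun _ => c) fun V₀ ho hVA => ⟨hc, hdom V₀ ho hVA⟩
  rwa [sum_measureReal_inter_blob w A o hoA] at h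

open SteinerBlob in
/-- **CIL at a uniformly port-dominating designee** (corollary): `μ{1 ≤ N_o ≤ j} ≤ μ{|π(c)| ≤ j}`. [this work] -/
theorem cumulativeIsolation_of_portDominated (w : Sym2 (Fin n) → unitInterval) (A : Finset (Fin n)) (o c : Fin n)
    (j : ℕ) (hoA : o ∉ A) (hc : c ∈ A)
    (hdom : ∀ V₀ : Finset (Fin n), o ∈ V₀ → Disjoint V₀ A →
      ∀ v ∈ A, (∃ u ∈ V₀, w s(u, v) ≠ 0) →
        (prodBernoulli w).real {ω : BondConfig (Fin n) |
            (A.filter fun z => ω ∈ openConnIn ((↑V₀ : Set (Fin n))ᶜ) v z).card ≤ j} ≤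
          (prodBernoulli w).real {ω : BondConfig (Fin n) |
            (A.filter fun z => ω ∈ openConnIn ((↑V₀ : Set (Fin n))ᶜ) c z).card ≤ j}) :
    (prodBernoulli w).real {ω : BondConfig (Fin n) |
        1 ≤ (A.filter fun x => ω ∈ openConn o x).card ∧ (A.filter fun x => ω ∈ openConn o x).card ≤ j} ≤
      (prodBernoulli w).real {ω : BondConfig (Fin n) | (A.filter fun x => ω ∈ openConn c x).card ≤ j} :=
  (tform_of_portDominated w A o c j hoA hc hdom).trans
    (measureReal_mono Set.inter_subset_right (measure_ne_top _ _))

end Summit.CriticalPhenomena.PercolationContinuityZ3.Theorems
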